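import Summits.RiemannHypothesis.RiemannHypothesis.Theorems.SuzukiFlowPairingWeilSide
import Summits.RiemannHypothesis.RiemannHypothesis.Theorems.SuzukiFlowPairingArchSeries

/-!
# Operator side of `FlowPairing`: the summable majorant of the Gauss–digamma pieces (column DBR; RH-FREE)

RH-FREE throughout; nothing here bears on the truth of RH.  The digamma part of the flow kernel
(`Theorems.SuzukiFlowKernelReal.flowKernel_eq`) is the series `Σ_k τ_k` of
`τ_k(w) = K_θ(w)/(k+1) − 2∫₀^∞ e^{−(2k+½)v} K_θ(w − v) dv`.  Writing `2∫₀^∞ e^{−(2k+½)v}dv = 1/(k+¼)`,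
`τ_k(w) = K_θ(w)(1/(k+1) − 1/(k+¼)) + 2∫₀^∞ e^{−(2k+½)v}(K_θ(w) − K_θ(w−v)) dv`, and the HÖLDER modulus of
`K_θ` (`Theorems.SuzukiKernelHolder`) gives the uniform summable majorant

* **`abs_gaussPiece_le`** — for `w ≤ T`:
  `|τ_k(w)| ≤ 4π (3M/(k+1)² + (2C + 4M) Γ(ε+1) (1/(2k+½))^{ε+1})` (the majorant of
  `SuzukiFlowPairing.summable_archSeriesMajorant M C ε`), with `M = sup_{(−∞,T]}|K_θ|` and `(C, ε)` the Hölder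
  data of `K_θ` on `(−∞, T]`;

the domination that carries `Σ_k` through the window integrations of `⟨𝖪_θ[t]f, 𝒥_θ[t]f⟩`.

References: [Su20] M. Suzuki, ASPM 84 (2020); E. Bombieri, Rend. Lincei (9) 11 (2000), §2 (2.6)–(2.7).
-/

noncomputable section

-- D-0017: `Summit.<S>.<S>.…` is the designed namespace of a single-problem summit.
set_option linter.dupNamespace false

open Complex MeasureTheory Set Filter Topology
open scoped Real

namespace Summit.RiemannHypothesis.RiemannHypothesis.Theorems.SuzukiThetaFlow

open Literature.NumberTheory.LFunctions
open Summit.RiemannHypothesis.RiemannHypothesis.Theorems.SuzukiKernelSemigroup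
open Summit.RiemannHypothesis.RiemannHypothesis.Theorems.SuzukiFlowPairing

variable {θ : ℝ}

/-- RH-FREE.  The Gauss weight integrand `e^{−(2k+½)v} K_θ(w−v)` is integrable on `(0,∞)` (`K_θ` bounded on
`(−∞, w]`). -/
theorem integrableOn_gaussWeight_mul_limKernel (hθ : 1 < θ) (k : ℕ) (w : ℝ) :
    IntegrableOn (fun v : ℝ ↦ Real.exp ((-2 * (k : ℝ) - 1 / 2) * v) * limKernel θ (w - v)) (Ioi 0) := by
  obtain ⟨M, -, hM⟩ := exists_abs_limKernel_le_of_le hθ w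
  have hr : (0 : ℝ) < 2 * k + 1 / 2 := by positivity
  have hE : IntegrableOn (fun v : ℝ ↦ Real.exp ((-2 * (k : ℝ) - 1 / 2) * v)) (Ioi 0) :=
    (exp_neg_integrableOn_Ioi 0 hr).congr_fun (fun v _ ↦ by ring_nf) measurableSet_Ioi
  have hKm : AEStronglyMeasurable (fun v : ℝ ↦ limKernel θ (w - v)) (volume.restrict (Ioi 0)) :=
    ((Suzuki2020_thm12_continuous hθ).comp (continuous_const.sub continuous_id)).aestronglyMeasurable
  have hKb : ∀ᵐ v ∂(volume.restrict (Ioi (0 : ℝ))), ‖limKernel θ (w - v)‖ ≤ M :=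
    (ae_restrict_iff' measurableSet_Ioi).2 (Eventually.of_forall fun v hv ↦ by
      rw [Real.norm_eq_abs]; exact hM _ (by linarith [mem_Ioi.1 hv]))
  have h := Integrable.bdd_mul (c := M) hE hKm hKb
  exact h.congr (Eventually.of_forall fun v ↦ mul_comm _ _)

/-- RH-FREE.  **Hölder + boundedness control of the kernel increments on a half-line**: for `w ≤ T` and
`v > 0`, `|K_θ(w) − K_θ(w−v)| ≤ (C + 2M) v^ε` with `M = sup_{(−∞,T]}|K_θ|`, `(C,ε)` the Hölder data on
`(−∞,T]`. -/
theorem abs_limKernel_sub_shift_le {T M C ε : ℝ} (hM0 : 0 ≤ M) (hM : ∀ w : ℝ, w ≤ T → |limKernel θ w| ≤ M)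
    (hC : 0 ≤ C) (hε0 : 0 < ε)
    (hK : ∀ x y : ℝ, x ≤ T → y ≤ T → |x - y| ≤ 1 → |limKernel θ x - limKernel θ y| ≤ C * |x - y| ^ ε)
    {w v : ℝ} (hw : w ≤ T) (hv : 0 < v) :
    |limKernel θ w - limKernel θ (w - v)| ≤ (C + 2 * M) * v ^ ε := by
  have hvε : 0 ≤ v ^ ε := Real.rpow_nonneg hv.le ε
  rcases le_or_gt v 1 with hv1 | hv1
  · have h := hK w (w - v) hw (by linarith) (by rw [show w - (w - v) = v by ring, abs_of_pos hv]; exact hv1)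
    rw [show w - (w - v) = v by ring, abs_of_pos hv] at h
    nlinarith
  · have h1 : |limKernel θ w - limKernel θ (w - v)| ≤ 2 * M :=
      (abs_sub _ _).trans (by linarith [hM w hw, hM (w - v) (by linarith)])
    have h2 : 1 ≤ v ^ ε := Real.one_le_rpow hv1.le hε0.le
    nlinarith

/-- **RH-FREE · the summable majorant of the Gauss–digamma pieces**: for `θ > 1` and real `T` there are
`M, C ≥ 0` and `0 < ε ≤ 1` such that for every `w ≤ T` and every `k`,
`|K_θ(w)/(k+1) − 2∫₀^∞ e^{−(2k+½)v}K_θ(w−v)dv| ≤ 4π(3M/(k+1)² + (2C+4M)Γ(ε+1)(1/(2k+½))^{ε+1})`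
— termwise bounded by the summable `SuzukiFlowPairing.summable_archSeriesMajorant M C ε`.  Nothing here
bears on RH. -/
theorem abs_gaussPiece_le (hθ : 1 < θ) (T : ℝ) :
    ∃ M C ε : ℝ, 0 ≤ M ∧ 0 ≤ C ∧ 0 < ε ∧ ε ≤ 1 ∧ ∀ w : ℝ, w ≤ T → ∀ k : ℕ,
      |limKernel θ w / ((k : ℝ) + 1) -
          2 * ∫ v in Ioi (0 : ℝ), Real.exp ((-2 * (k : ℝ) - 1 / 2) * v) * limKernel θ (w - v)| ≤
        4 * π * (3 * M / ((k : ℝ) + 1) ^ 2 +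
          (2 * C + 4 * M) * Real.Gamma (ε + 1) * (1 / (2 * (k : ℝ) + 1 / 2)) ^ (ε + 1)) := by
  obtain ⟨M, hM0, hM⟩ := exists_abs_limKernel_le_of_le hθ T
  obtain ⟨C, ε, hC, hε0, hε1, hK⟩ := exists_abs_limKernel_sub_le_rpow_of_le hθ T
  refine ⟨M, C, ε, hM0, hC, hε0, hε1, fun w hw k ↦ ?_⟩
  have hr : (0 : ℝ) < 2 * k + 1 / 2 := by positivity
  obtain ⟨hGi, hGv⟩ := integral_rpow_mul_archWeight hε0 k
  have hIK := integrableOn_gaussWeight_mul_limKernel hθ k w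
  -- the constant part: `2∫₀^∞ e^{−(2k+½)v} dv · K(w) = K(w)/(k+¼)`
  have hE : IntegrableOn (fun v : ℝ ↦ Real.exp ((-2 * (k : ℝ) - 1 / 2) * v)) (Ioi 0) :=
    (exp_neg_integrableOn_Ioi 0 hr).congr_fun (fun v _ ↦ by ring_nf) measurableSet_Ioi
  have hEv : ∫ v in Ioi (0 : ℝ), Real.exp ((-2 * (k : ℝ) - 1 / 2) * v) = 1 / (2 * (k : ℝ) + 1 / 2) := by
    have h := Real.integral_rpow_mul_exp_neg_mul_Ioi (a := 1) (r := 2 * (k : ℝ) + 1 / 2) one_pos hr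
    rw [sub_self, Real.rpow_one, Real.Gamma_one, mul_one] at h
    rw [← h]
    refine setIntegral_congr_fun measurableSet_Ioi fun v _ ↦ ?_
    rw [Real.rpow_zero, one_mul]
    ring_nf
  -- split `τ_k(w) = K(w)(1/(k+1) − 1/(k+¼)) + 2∫ e(K(w) − K(w−v))`
  have hsplit : limKernel θ w / ((k : ℝ) + 1) -
      2 * ∫ v in Ioi (0 : ℝ), Real.exp ((-2 * (k : ℝ) - 1 / 2) * v) * limKernel θ (w - v) =
      limKernel θ w * (1 / ((k : ℝ) + 1) - 1 / ((k : ℝ) + 1 / 4)) +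
        2 * ∫ v in Ioi (0 : ℝ), Real.exp ((-2 * (k : ℝ) - 1 / 2) * v) * (limKernel θ w - limKernel θ (w - v)) := by
    have e1 : (fun v : ℝ ↦ Real.exp ((-2 * (k : ℝ) - 1 / 2) * v) * (limKernel θ w - limKernel θ (w - v))) =
        fun v ↦ limKernel θ w * Real.exp ((-2 * (k : ℝ) - 1 / 2) * v) -
          Real.exp ((-2 * (k : ℝ) - 1 / 2) * v) * limKernel θ (w - v) := by
      funext v; ring
    rw [e1, integral_sub (hE.const_mul _) hIK, integral_const_mul, hEv]
    have h14 : (k : ℝ) + 1 / 4 ≠ 0 := by positivity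
    have h12 : 2 * (k : ℝ) + 1 / 2 ≠ 0 := by positivity
    field_simp
    ring
  rw [hsplit]
  -- first summand
  have hk0 : (0 : ℝ) < (k : ℝ) + 1 := by positivity
  have hq : |1 / ((k : ℝ) + 1) - 1 / ((k : ℝ) + 1 / 4)| ≤ 3 / ((k : ℝ) + 1) ^ 2 := by
    have h14 : (0 : ℝ) < (k : ℝ) + 1 / 4 := by positivity
    rw [show 1 / ((k : ℝ) + 1) - 1 / ((k : ℝ) + 1 / 4) = -(3 / 4) / (((k : ℝ) + 1) * ((k : ℝ) + 1 / 4)) by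
      field_simp; ring, abs_div, abs_of_pos (mul_pos hk0 h14), show |(-(3 / 4) : ℝ)| = 3 / 4 by norm_num,
      div_le_div_iff₀ (mul_pos hk0 h14) (pow_pos hk0 2)]
    nlinarith
  have hA : |limKernel θ w * (1 / ((k : ℝ) + 1) - 1 / ((k : ℝ) + 1 / 4))| ≤ 3 * M / ((k : ℝ) + 1) ^ 2 := by
    rw [abs_mul]
    calc |limKernel θ w| * |1 / ((k : ℝ) + 1) - 1 / ((k : ℝ) + 1 / 4)| ≤ M * (3 / ((k : ℝ) + 1) ^ 2) :=
          mul_le_mul (hM w hw) hq (abs_nonneg _) hM0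
      _ = 3 * M / ((k : ℝ) + 1) ^ 2 := by ring
  -- second summand
  have hB : |2 * ∫ v in Ioi (0 : ℝ), Real.exp ((-2 * (k : ℝ) - 1 / 2) * v) * (limKernel θ w - limKernel θ (w - v))| ≤
      2 * ((C + 2 * M) * Real.Gamma (ε + 1) * (1 / (2 * (k : ℝ) + 1 / 2)) ^ (ε + 1)) := by
    rw [abs_mul, abs_two]
    refine mul_le_mul_of_nonneg_left ?_ zero_le_two
    have h1 : |∫ v in Ioi (0 : ℝ), Real.exp ((-2 * (k : ℝ) - 1 / 2) * v) * (limKernel θ w - limKernel θ (w - v))| ≤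
        ∫ v in Ioi (0 : ℝ), (C + 2 * M) * (v ^ ε * Real.exp (-(2 * k + 1 / 2) * v)) := by
      rw [← Real.norm_eq_abs]
      refine norm_integral_le_of_norm_le (hGi.const_mul _) ?_
      refine (ae_restrict_iff' measurableSet_Ioi).2 (Eventually.of_forall fun v hv ↦ ?_)
      rw [norm_mul, Real.norm_eq_abs, Real.norm_eq_abs, Real.abs_exp]
      have h := abs_limKernel_sub_shift_le hM0 hM hC hε0 hK hw (mem_Ioi.1 hv)
      have hE0 : 0 ≤ Real.exp ((-2 * (k : ℝ) - 1 / 2) * v) := (Real.exp_pos _).le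
      calc Real.exp ((-2 * (k : ℝ) - 1 / 2) * v) * |limKernel θ w - limKernel θ (w - v)|
          ≤ Real.exp ((-2 * (k : ℝ) - 1 / 2) * v) * ((C + 2 * M) * v ^ ε) := mul_le_mul_of_nonneg_left h hE0
        _ = (C + 2 * M) * (v ^ ε * Real.exp (-(2 * k + 1 / 2) * v)) := by ring_nf
    rw [integral_const_mul, hGv] at h1
    calc |∫ v in Ioi (0 : ℝ), Real.exp ((-2 * (k : ℝ) - 1 / 2) * v) * (limKernel θ w - limKernel θ (w - v))|
        ≤ (C + 2 * M) * ((1 / (2 * (k : ℝ) + 1 / 2)) ^ (ε + 1) * Real.Gamma (ε + 1)) := h1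
      _ = (C + 2 * M) * Real.Gamma (ε + 1) * (1 / (2 * (k : ℝ) + 1 / 2)) ^ (ε + 1) := by ring
  have hπ : (1 : ℝ) ≤ 4 * π := by nlinarith [Real.pi_gt_three]
  have hpos1 : 0 ≤ 3 * M / ((k : ℝ) + 1) ^ 2 := by positivity
  have hpos2 : 0 ≤ (C + 2 * M) * Real.Gamma (ε + 1) * (1 / (2 * (k : ℝ) + 1 / 2)) ^ (ε + 1) := by
    have := Real.Gamma_pos_of_pos (by linarith : 0 < ε + 1)
    positivity
  calc |limKernel θ w * (1 / ((k : ℝ) + 1) - 1 / ((k : ℝ) + 1 / 4)) +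
        2 * ∫ v in Ioi (0 : ℝ), Real.exp ((-2 * (k : ℝ) - 1 / 2) * v) * (limKernel θ w - limKernel θ (w - v))|
      ≤ 3 * M / ((k : ℝ) + 1) ^ 2 + 2 * ((C + 2 * M) * Real.Gamma (ε + 1) * (1 / (2 * (k : ℝ) + 1 / 2)) ^ (ε + 1)) :=
        (abs_add_le _ _).trans (add_le_add hA hB)
    _ = 1 * (3 * M / ((k : ℝ) + 1) ^ 2 + (2 * C + 4 * M) * Real.Gamma (ε + 1) * (1 / (2 * (k : ℝ) + 1 / 2)) ^ (ε + 1)) := by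
        ring
    _ ≤ 4 * π * (3 * M / ((k : ℝ) + 1) ^ 2 +
          (2 * C + 4 * M) * Real.Gamma (ε + 1) * (1 / (2 * (k : ℝ) + 1 / 2)) ^ (ε + 1)) := by
        refine mul_le_mul_of_nonneg_right hπ ?_
        nlinarith

end Summit.RiemannHypothesis.RiemannHypothesis.Theorems.SuzukiThetaFlow

end
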